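import Mathlib.Analysis.InnerProductSpace.PiL2
import Mathlib.Analysis.Calculus.ContDiff.Operations
import Mathlib.Analysis.SpecialFunctions.Sqrt
import Mathlib.Analysis.Calculus.ContDiff.FiniteDimension
import HarnessLib

/-!
# A smooth orthonormalising frame for a family of positive definite forms on `ℝ³` (Gram–Schmidt)

Auxiliary file of helper `helper_bott_tube` of stub `helper_sliceGluing_bottRecognition` (fibred
Morse–Bott recognition of the polar tube), line `Sketch`, crux `SblfDescent.RungOne`.

(Crux item stmt-SmoothPoincare4-18531; skeleton `Cruxes/RungOne/Lines/Sketch.lean`.)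

The fibrewise Morse lemma with a global adapted frame
(`Literature.Topology.FourManifolds.Splitting.exists_periodic_fibrewiseMorseCoords_of_frame`,
Hirsch 1976, Ch. 6 §1 with a parameter; Banyaga–Hurtubise 2004, Thm. 2) asks for smooth
invertible `M(p)` with `H(p)(a, b) = 2 B₀ (M(p) a, M(p) b)` for all parameters `p`.  For a smooth
family `H` of symmetric POSITIVE DEFINITE forms on `ℝ³` (the fibre Hessians along a
nondegenerate maximum circle, after a sign) such a frame with `B₀` the Euclidean inner product is
given by the Gram–Schmidt process applied to the standard basis with respect to `H(p)`: the
resulting `H(p)`-orthonormal basis `f₁, f₂, f₃` depends smoothly on `p` (square roots of positive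
quantities), `Minv(p) a = Σ aᵢ fᵢ`, `M(p) x = (H(p)(x, fᵢ))ᵢ`, and
`H(p)(x, y) = ⟪M(p) x, M(p) y⟫` (Parseval).  Since `M(p)` is a function of `H(p)` alone, a
periodic family has a periodic frame.  Main statement: `BottGS.exists_frame`.

## References

* M. W. Hirsch, *Differential Topology*, GTM 33 (1976), Ch. 6 §1. [HirschDT1976]
* A. Banyaga, D. E. Hurtubise, *A proof of the Morse–Bott Lemma*, Expo. Math. 22 (2004), Thm. 2.
  [BanyagaHurtubise2004]
-/

set_option linter.dupNamespace false

noncomputable section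

open scoped ContDiff RealInnerProductSpace
open Set Function

namespace Summit.SmoothPoincare4.SmoothPoincare4.Cruxes.RungOne.Sketch

namespace BottGS

/-- Short name for `ℝ³`. [folklore] -/
abbrev V3 : Type := EuclideanSpace ℝ (Fin 3)

/-- Short name for the bilinear forms on `ℝ³`. [folklore] -/
abbrev Form : Type := V3 →L[ℝ] V3 →L[ℝ] ℝ

/-- The standard basis vector `eᵢ`. [folklore] -/
abbrev sb (i : Fin 3) : V3 := EuclideanSpace.single i 1

/-! ### Bilinear bookkeeping -/

/-- `B (c • u) v = c B u v`. [folklore] -/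
theorem form_smul_left (B : Form) (c : ℝ) (u v : V3) : B (c • u) v = c * B u v := by
  rw [map_smul]; rfl

/-- `B u (c • v) = c B u v`. [folklore] -/
theorem form_smul_right (B : Form) (c : ℝ) (u v : V3) : B u (c • v) = c * B u v := by
  rw [map_smul]; rfl

/-- `B (u - w) v = B u v - B w v`. [folklore] -/
theorem form_sub_left (B : Form) (u w v : V3) : B (u - w) v = B u v - B w v := by
  rw [map_sub]; rfl

/-- `B u (v - w) = B u v - B u w`. [folklore] -/
theorem form_sub_right (B : Form) (u v w : V3) : B u (v - w) = B u v - B u w := by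
  rw [map_sub]

/-- `B u (v + w) = B u v + B u w`. [folklore] -/
theorem form_add_right (B : Form) (u v w : V3) : B u (v + w) = B u v + B u w := by
  rw [map_add]

/-- `B (u + w) v = B u v + B w v`. [folklore] -/
theorem form_add_left (B : Form) (u w v : V3) : B (u + w) v = B u v + B w v := by
  rw [map_add]; rfl

/-! ### The Gram–Schmidt vectors -/

/-- `n₁ = B(e₀, e₀)`. [folklore] -/
def n1 (B : Form) : ℝ := B (sb 0) (sb 0)
/-- `f₁ = e₀ / √n₁`. [folklore] -/
def f1 (B : Form) : V3 := (√(n1 B))⁻¹ • sb 0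
/-- `g₂ = e₁ - B(e₁, f₁) f₁`. [folklore] -/
def g2 (B : Form) : V3 := sb 1 - (B (sb 1) (f1 B)) • f1 B
/-- `n₂ = B(g₂, g₂)`. [folklore] -/
def n2 (B : Form) : ℝ := B (g2 B) (g2 B)
/-- `f₂ = g₂ / √n₂`. [folklore] -/
def f2 (B : Form) : V3 := (√(n2 B))⁻¹ • g2 B
/-- `g₃ = e₂ - B(e₂, f₁) f₁ - B(e₂, f₂) f₂`. [folklore] -/
def g3 (B : Form) : V3 := sb 2 - (B (sb 2) (f1 B)) • f1 B - (B (sb 2) (f2 B)) • f2 B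
/-- `n₃ = B(g₃, g₃)`. [folklore] -/
def n3 (B : Form) : ℝ := B (g3 B) (g3 B)
/-- `f₃ = g₃ / √n₃`. [folklore] -/
def f3 (B : Form) : V3 := (√(n3 B))⁻¹ • g3 B

/-- The frame `(f₁, f₂, f₃)`. [folklore] -/
def fr (B : Form) (i : Fin 3) : V3 := ![f1 B, f2 B, f3 B] i

/-- **`Minv(B) a = Σ aᵢ fᵢ`.** [folklore] -/
def Minv (B : Form) : V3 →L[ℝ] V3 := ∑ i : Fin 3, (EuclideanSpace.proj i).smulRight (fr B i)

/-- **`M(B) x = (B(x, fᵢ))ᵢ`.** [folklore] -/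
def M (B : Form) : V3 →L[ℝ] V3 :=
  ∑ i : Fin 3, ((ContinuousLinearMap.apply ℝ ℝ (fr B i)).comp B).smulRight (sb i)

/-- `Minv(B) a = Σ aᵢ fᵢ` on vectors. [folklore] -/
theorem Minv_apply (B : Form) (a : V3) : Minv B a = ∑ i : Fin 3, a i • fr B i := by
  simp [Minv]

/-- `M(B) x = Σ B(x, fᵢ) eᵢ` on vectors. [folklore] -/
theorem M_apply (B : Form) (x : V3) : M B x = ∑ i : Fin 3, (B x (fr B i)) • sb i := by
  simp [M]

/-- Coordinates of `M(B) x`: `(M(B) x)ᵢ = B(x, fᵢ)`. [folklore] -/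
theorem M_apply_coord (B : Form) (x : V3) (i : Fin 3) : M B x i = B x (fr B i) := by
  rw [M_apply]
  fin_cases i <;> simp [Fin.sum_univ_three]

section PosDef

variable {B : Form} (hs : ∀ u v : V3, B u v = B v u) (hp : ∀ v : V3, v ≠ 0 → 0 < B v v)
include hs hp

omit hs in
/-- `n₁ > 0`. [folklore] -/
theorem n1_pos : 0 < n1 B := hp _ (by
  intro h; have := congrArg (fun v : V3 => v 0) h; simp at this)

omit hs in
/-- `B(f₁, f₁) = 1`. [folklore] -/
theorem B_f1_f1 : B (f1 B) (f1 B) = 1 := by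
  have h := n1_pos hp
  rw [f1, form_smul_left, form_smul_right, ← n1, ← mul_assoc, ← mul_inv, ← pow_two,
    Real.sq_sqrt h.le, inv_mul_cancel₀ h.ne']

omit hs in
/-- `B(g₂, f₁) = 0`. [folklore] -/
theorem B_g2_f1 : B (g2 B) (f1 B) = 0 := by
  rw [g2, form_sub_left, form_smul_left, B_f1_f1 hp, mul_one, sub_self]

omit hs hp in
/-- `g₂ ≠ 0` (its second coordinate is `1`). [folklore] -/
theorem g2_ne_zero : g2 B ≠ 0 := by
  intro h
  have := congrArg (fun v : V3 => v 1) h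
  simp [g2, f1] at this

omit hs in
/-- `n₂ > 0`. [folklore] -/
theorem n2_pos : 0 < n2 B := hp _ g2_ne_zero

omit hs in
/-- `B(f₂, f₁) = 0`. [folklore] -/
theorem B_f2_f1 : B (f2 B) (f1 B) = 0 := by
  rw [f2, form_smul_left, B_g2_f1 hp, mul_zero]

/-- `B(f₁, f₂) = 0`. [folklore] -/
theorem B_f1_f2 : B (f1 B) (f2 B) = 0 := by rw [hs, B_f2_f1 hp]

omit hs in
/-- `B(f₂, f₂) = 1`. [folklore] -/
theorem B_f2_f2 : B (f2 B) (f2 B) = 1 := by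
  have h := n2_pos hp
  rw [f2, form_smul_left, form_smul_right, ← n2, ← mul_assoc, ← mul_inv, ← pow_two,
    Real.sq_sqrt h.le, inv_mul_cancel₀ h.ne']

omit hs in
/-- `B(g₃, f₁) = 0`. [folklore] -/
theorem B_g3_f1 : B (g3 B) (f1 B) = 0 := by
  rw [g3, form_sub_left, form_sub_left, form_smul_left, form_smul_left, B_f1_f1 hp,
    B_f2_f1 hp]; ring

/-- `B(g₃, f₂) = 0`. [folklore] -/
theorem B_g3_f2 : B (g3 B) (f2 B) = 0 := by
  rw [g3, form_sub_left, form_sub_left, form_smul_left, form_smul_left, B_f1_f2 hs hp,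
    B_f2_f2 hp]; ring

omit hs hp in
/-- `g₃ ≠ 0` (its third coordinate is `1`). [folklore] -/
theorem g3_ne_zero : g3 B ≠ 0 := by
  intro h
  have := congrArg (fun v : V3 => v 2) h
  simp [g3, g2, f2, f1] at this

omit hs in
/-- `n₃ > 0`. [folklore] -/
theorem n3_pos : 0 < n3 B := hp _ g3_ne_zero

/-- `B(f₃, f₁) = 0`, `B(f₃, f₂) = 0`, `B(f₃, f₃) = 1`. [folklore] -/
theorem B_f3 : B (f3 B) (f1 B) = 0 ∧ B (f3 B) (f2 B) = 0 ∧ B (f3 B) (f3 B) = 1 := by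
  have h := n3_pos hp
  refine ⟨?_, ?_, ?_⟩
  · rw [f3, form_smul_left, B_g3_f1 hp, mul_zero]
  · rw [f3, form_smul_left, B_g3_f2 hs hp, mul_zero]
  · rw [f3, form_smul_left, form_smul_right, ← n3, ← mul_assoc, ← mul_inv, ← pow_two,
      Real.sq_sqrt h.le, inv_mul_cancel₀ h.ne']

/-- **Orthonormality**: `B(fᵢ, fⱼ) = δᵢⱼ`. [folklore] -/
theorem B_fr_fr (i j : Fin 3) : B (fr B i) (fr B j) = if i = j then 1 else 0 := by
  obtain ⟨h31, h32, h33⟩ := B_f3 hs hp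
  fin_cases i <;> fin_cases j <;>
    simp [fr, B_f1_f1 hp, B_f1_f2 hs hp, B_f2_f1 hp, B_f2_f2 hp, h31, h32, h33, hs (f1 B) (f3 B),
      hs (f2 B) (f3 B)]

/-- **`M ∘ Minv = id`.** [folklore] -/
theorem M_Minv (a : V3) : M B (Minv B a) = a := by
  have hc : ∀ i, B (Minv B a) (fr B i) = a i := fun i => by
    rw [Minv_apply, Fin.sum_univ_three, form_add_left, form_add_left, form_smul_left, form_smul_left,
      form_smul_left, B_fr_fr hs hp, B_fr_fr hs hp, B_fr_fr hs hp]
    fin_cases i <;> simp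
  ext i
  rw [M_apply_coord, hc]

/-- The standard basis vectors in the frame: `e₀ = √n₁ f₁`, `e₁ = B(e₁,f₁) f₁ + √n₂ f₂`,
`e₂ = B(e₂,f₁) f₁ + B(e₂,f₂) f₂ + √n₃ f₃`; hence `Minv (M eₖ) = eₖ`. [folklore] -/
theorem Minv_M_sb (k : Fin 3) : Minv B (M B (sb k)) = sb k := by
  -- every `x = Σ cᵢ fᵢ` satisfies `Minv (M x) = x`
  have key : ∀ c : V3, Minv B (M B (Minv B c)) = Minv B c := fun c => by rw [M_Minv hs hp]
  have h1 := n1_pos hp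
  have h2 := n2_pos hp
  have h3 := n3_pos hp
  have hs1 : √(n1 B) * (√(n1 B))⁻¹ = 1 := mul_inv_cancel₀ (Real.sqrt_pos.2 h1).ne'
  have hs2 : √(n2 B) * (√(n2 B))⁻¹ = 1 := mul_inv_cancel₀ (Real.sqrt_pos.2 h2).ne'
  have hs3 : √(n3 B) * (√(n3 B))⁻¹ = 1 := mul_inv_cancel₀ (Real.sqrt_pos.2 h3).ne'
  -- the three expansions
  have e0 : sb 0 = Minv B (EuclideanSpace.single 0 (√(n1 B))) := by
    rw [Minv_apply, Fin.sum_univ_three]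
    simp [fr, f1, smul_smul, hs1]
  have e1 : sb 1 = Minv B (EuclideanSpace.single 0 (B (sb 1) (f1 B)) + EuclideanSpace.single 1 (√(n2 B))) := by
    rw [Minv_apply, Fin.sum_univ_three]
    simp only [fr, Matrix.cons_val_zero, Matrix.cons_val_one, Matrix.cons_val]
    have : √(n2 B) • f2 B = g2 B := by rw [f2, smul_smul, hs2, one_smul]
    simp [this, g2]
  have e2 : sb 2 = Minv B (EuclideanSpace.single 0 (B (sb 2) (f1 B)) + EuclideanSpace.single 1 (B (sb 2) (f2 B)) +
      EuclideanSpace.single 2 (√(n3 B))) := by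
    rw [Minv_apply, Fin.sum_univ_three]
    simp only [fr, Matrix.cons_val_zero, Matrix.cons_val_one, Matrix.cons_val]
    have : √(n3 B) • f3 B = g3 B := by rw [f3, smul_smul, hs3, one_smul]
    simp [this, g3]
  fin_cases k
  · exact (congrArg (fun x => Minv B (M B x)) e0).trans ((key _).trans e0.symm)
  · exact (congrArg (fun x => Minv B (M B x)) e1).trans ((key _).trans e1.symm)
  · exact (congrArg (fun x => Minv B (M B x)) e2).trans ((key _).trans e2.symm)

/-- **`Minv ∘ M = id`.** [folklore] -/
theorem Minv_M (x : V3) : Minv B (M B x) = x := by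
  have hx : x = ∑ k : Fin 3, x k • sb k := by
    ext i; fin_cases i <;> simp [Fin.sum_univ_three]
  conv_lhs => rw [hx]
  rw [map_sum, map_sum]
  conv_rhs => rw [hx]
  refine Finset.sum_congr rfl fun k _ => ?_
  rw [map_smul, map_smul, Minv_M_sb hs hp]

/-- **Parseval: `B(x, y) = ⟪M x, M y⟫`.** [folklore] -/
theorem B_eq_inner (x y : V3) : B x y = ⟪M B x, M B y⟫ := by
  have hy : y = ∑ i : Fin 3, (B y (fr B i)) • fr B i := by
    conv_lhs => rw [← Minv_M hs hp y]
    rw [Minv_apply]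
    refine Finset.sum_congr rfl fun i _ => ?_
    rw [M_apply_coord]
  conv_lhs => rw [hy]
  rw [map_sum, Fin.sum_univ_three, form_smul_right, form_smul_right, form_smul_right]
  rw [PiLp.inner_apply, Fin.sum_univ_three]
  simp only [M_apply_coord, RCLike.inner_apply, conj_trivial, hs y]

end PosDef

/-! ### Smooth dependence on a parameter -/

section Smooth

variable {P : Type*} [NormedAddCommGroup P] [NormedSpace ℝ P] {H : P → Form}
  (hH : ContDiff ℝ ∞ H) (hp : ∀ (p : P) (v : V3), v ≠ 0 → 0 < H p v v)
include hH

/-- `p ↦ H(p)(u(p), v(p))` is smooth for smooth `u`, `v`. [folklore] -/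
theorem contDiff_apply₂ {u v : P → V3} (hu : ContDiff ℝ ∞ u) (hv : ContDiff ℝ ∞ v) :
    ContDiff ℝ ∞ fun p => H p (u p) (v p) :=
  (hH.clm_apply hu).clm_apply hv

include hp

/-- `f₁` is smooth in the parameter. [folklore] -/
theorem contDiff_f1 : ContDiff ℝ ∞ fun p => f1 (H p) := by
  have h1 : ContDiff ℝ ∞ fun p => n1 (H p) := contDiff_apply₂ hH contDiff_const contDiff_const
  exact ((h1.sqrt fun p => (n1_pos (hp p)).ne').inv
    fun p => (Real.sqrt_pos.2 (n1_pos (hp p))).ne').smul contDiff_const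

/-- `f₂` is smooth in the parameter. [folklore] -/
theorem contDiff_f2 : ContDiff ℝ ∞ fun p => f2 (H p) := by
  have hf1 := contDiff_f1 hH hp
  have hg2 : ContDiff ℝ ∞ fun p => g2 (H p) :=
    contDiff_const.sub ((contDiff_apply₂ hH contDiff_const hf1).smul hf1)
  have h2 : ContDiff ℝ ∞ fun p => n2 (H p) := contDiff_apply₂ hH hg2 hg2
  exact ((h2.sqrt fun p => (n2_pos (hp p)).ne').inv
    fun p => (Real.sqrt_pos.2 (n2_pos (hp p))).ne').smul hg2

/-- `f₃` is smooth in the parameter. [folklore] -/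
theorem contDiff_f3 : ContDiff ℝ ∞ fun p => f3 (H p) := by
  have hf1 := contDiff_f1 hH hp
  have hf2 := contDiff_f2 hH hp
  have hg3 : ContDiff ℝ ∞ fun p => g3 (H p) :=
    (contDiff_const.sub ((contDiff_apply₂ hH contDiff_const hf1).smul hf1)).sub
      ((contDiff_apply₂ hH contDiff_const hf2).smul hf2)
  have h3 : ContDiff ℝ ∞ fun p => n3 (H p) := contDiff_apply₂ hH hg3 hg3
  exact ((h3.sqrt fun p => (n3_pos (hp p)).ne').inv
    fun p => (Real.sqrt_pos.2 (n3_pos (hp p))).ne').smul hg3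

/-- The frame is smooth in the parameter. [folklore] -/
theorem contDiff_fr (i : Fin 3) : ContDiff ℝ ∞ fun p => fr (H p) i := by
  fin_cases i
  · exact contDiff_f1 hH hp
  · exact contDiff_f2 hH hp
  · exact contDiff_f3 hH hp

/-- `Minv` is smooth in the parameter. [folklore] -/
theorem contDiff_Minv : ContDiff ℝ ∞ fun p => Minv (H p) := by
  refine contDiff_clm_apply_iff.2 fun a => ?_
  simp only [Minv_apply]
  exact ContDiff.sum fun i _ => (contDiff_fr hH hp i).const_smul (a i)

/-- `M` is smooth in the parameter. [folklore] -/
theorem contDiff_M : ContDiff ℝ ∞ fun p => M (H p) := by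
  refine contDiff_clm_apply_iff.2 fun x => ?_
  simp only [M_apply]
  exact ContDiff.sum fun i _ => (contDiff_apply₂ hH contDiff_const (contDiff_fr hH hp i)).smul contDiff_const

end Smooth

/-- **A smooth orthonormalising frame for a smooth family of positive definite forms on `ℝ³`.**
If `H : P → (ℝ³ →L ℝ³ →L ℝ)` is `C^∞` with every `H(p)` symmetric and positive definite, then there
are `C^∞` maps `M, Minv : P → (ℝ³ →L ℝ³)`, mutually inverse, depending on `p` only through `H(p)`,
with `H(p)(x, y) = ⟪M(p) x, M(p) y⟫` (Gram–Schmidt with respect to `H(p)`).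
[cite: HirschDT1976, Ch. 6 §1] [cite: BanyagaHurtubise2004, Thm. 2] -/
theorem exists_frame {P : Type*} [NormedAddCommGroup P] [NormedSpace ℝ P]
    {H : P → (EuclideanSpace ℝ (Fin 3) →L[ℝ] EuclideanSpace ℝ (Fin 3) →L[ℝ] ℝ)} (hH : ContDiff ℝ ∞ H)
    (hs : ∀ (p : P) (u v : EuclideanSpace ℝ (Fin 3)), H p u v = H p v u)
    (hp : ∀ (p : P) (v : EuclideanSpace ℝ (Fin 3)), v ≠ 0 → 0 < H p v v) :
    ∃ M Minv : P → (EuclideanSpace ℝ (Fin 3) →L[ℝ] EuclideanSpace ℝ (Fin 3)),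
      ContDiff ℝ ∞ M ∧ ContDiff ℝ ∞ Minv ∧ (∀ p q, H p = H q → M p = M q ∧ Minv p = Minv q) ∧
      (∀ p a, M p (Minv p a) = a) ∧ (∀ p x, Minv p (M p x) = x) ∧
      ∀ p x y, H p x y = ⟪M p x, M p y⟫ :=
  ⟨fun p => M (H p), fun p => Minv (H p), contDiff_M hH hp, contDiff_Minv hH hp,
    fun p q h => by simp [h], fun p a => M_Minv (hs p) (hp p) a, fun p x => Minv_M (hs p) (hp p) x,
    fun p x y => B_eq_inner (hs p) (hp p) x y⟩

end BottGS

end Summit.SmoothPoincare4.SmoothPoincare4.Cruxes.RungOne.Sketch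

end
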